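import Summits.Ventures.QEC.Census.CertCoverProducers
import Summits.Ventures.QEC.Census.CertCoverCosetD
import Summits.Ventures.QEC.Census.BB.BB288.CoverFast
import Summits.Ventures.QEC.Census.BB.BB288Rank
import Summits.Ventures.QEC.Census.BB.BB288RankX
import Summits.Ventures.QEC.Theorems.BB144DistanceCertificateNoZLogicalBelowTwelve
import Summits.Ventures.QEC.Theorems.BB288DistanceCertificateLowerZOfFlat
import HarnessLib

/-!
# `[[288,12,18]]` cover certificate — CORE: the Prop-level hypotheses of the assembly (qec lane ε, type-10 side)

From search-9's decided DATA modules (`CoverTables`, `CoverLogicals`/`CoverLogicals288`, `CoverGens`) and the tree's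
rank certificates / flat distance theorems, this file discharges once — with NOTHING evaluated at 288 bits beyond the
cited verdicts — the hypotheses the generic assembly (`CertCoverAssembly` T0/T0′/T1/T2, `CertCoverProducers`) and the
per-problem one-liners (HOME COVER-ASSEMBLY-TEMPLATE §1–§2) consume:
* `comm144`, `comm72`; core structural verdicts `core288`, `core144`, `core72` (`bzCoreOK_of_parts`: rank certificates
  of BB288Rank/BB144Rank/BB72Rank + the decided pairings `logOK288/144/72` + `n = r_X + r_Z + 12`);
* `hDq1`, `hDq2` — kernel-span hypotheses of the level lemmas (`ker_subset_span_of_core[_aug]`, `D1 = bb144HZ ++ LZ144`,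
  `D2 = bb72HZ ++ LZ72`, the level-2→1 system augmented by `Lam2.map cov2.push`);
* `hLab288` (L1 in label form for T0), `hpushKer288` (T2), `hZZ` / `hspan2_288` (T2: `P₂ (P₁ v) ∈ rowspace H^Z₇₂`);
* the `u = 0` case `noBadOver_zero22` / `noBadOver_zero16` from BB144's KERNEL distance `twelve_le` through
  `noBadOver_zero_of_quotient` (`16 ≤ 22 < 2·12`), and the `H^Z₁₄₄`-row shortcut `noBadOver_pushRow`;
* `closes_of_flat` : the flat word statement ⇒ route item `NoZLogicalBelowEighteen` (via p500427).
HONEST FRAMING: per-code glue, everything proved, tier KERNEL, axioms standard; the automorphism tables (`hauts`) and the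
problem / witness verdicts arrive in their own modules; the final assembly imports this file.
-/

set_option exponentiation.threshold 512

namespace Summit.Ventures.QEC.Census.BB288Cover

open Matrix Summit.Ventures.QEC.Census Literature.InformationTheory.QuantumCodes

/-! ## Commutation and core structural verdicts of the three codes -/

/-- `H^X₁₄₄ · (H^Z₁₄₄)ᵀ = 0` on the word lists (typed BB144 identity transported along `rowMatrix_bb144H*`). -/
theorem comm144 : rowMatrix 144 bb144HX * (rowMatrix 144 bb144HZ)ᵀ = 0 := by
  rw [rowMatrix_bb144HX, rowMatrix_bb144HZ]; exact BB.bb144.HXFlat_mul_HZFlat_transpose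

/-- `H^X₇₂ · (H^Z₇₂)ᵀ = 0` on the word lists. -/
theorem comm72 : rowMatrix 72 bb72HX * (rowMatrix 72 bb72HZ)ᵀ = 0 := by
  rw [rowMatrix_bb72HX, rowMatrix_bb72HZ, ← Summit.Ventures.QEC.BB.bb72_HXFlat_eq_ofSupports,
    ← Summit.Ventures.QEC.BB.bb72_HZFlat_eq_ofSupports]
  exact BB.bb72.HXFlat_mul_HZFlat_transpose

/-- Core structural verdict of `BB.bb288` (chunked rank certificates `r = 138, 138`, pairing `logOK288`, `288 = 138+138+12`). -/
theorem core288 : bzCoreOK 288 bb288HX bb288HZ bb288RankCertX bb288RankCertZ LZ288 LX288 none = true :=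
  bzCoreOK_of_parts bb288RankCertX_check bb288RankCertZ_check logOK288 (by decide)

/-- Core structural verdict of `BB.bb144` (`r = 66, 66`, `logOK144`). -/
theorem core144 : bzCoreOK 144 bb144HX bb144HZ bb144RankCertX bb144RankCertZ LZ144 LX144 none = true :=
  bzCoreOK_of_parts bb144RankCertX_check bb144RankCertZ_check logOK144 (by decide)

/-- Core structural verdict of `BB.bb72` (`r = 30, 30`, `logOK72`). -/
theorem core72 : bzCoreOK 72 bb72HX bb72HZ bb72RankCertX bb72RankCertZ LZ72 LX72 none = true :=
  bzCoreOK_of_parts bb72RankCertX_check bb72RankCertZ_check logOK72 (by decide)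

/-! ## Kernel-span hypotheses of the level lemmas -/

/-- `ker H^X₁₄₄ ⊆ span D1` (`D1 = bb144HZ ++ LZ144`): the `hDq` of every level-1→0 problem. -/
theorem hDq1 : ∀ z : Fin 144 → ZMod 2, rowMatrix 144 bb144HX *ᵥ z = 0 →
    z ∈ Submodule.span (ZMod 2) (Set.range fun i : Fin D1.length => ofBits 144 D1[i]) :=
  ker_subset_span_of_core comm144 core144

/-- `ker [H^X₇₂ ; Lam2.map P₂] ⊆ span D2` (`D2 = bb72HZ ++ LZ72`): the `hDq` of every level-2→1 problem. -/
theorem hDq2 : ∀ z : Fin 72 → ZMod 2, rowMatrix 72 (bb72HX ++ Lam2.map cov2.push) *ᵥ z = 0 →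
    z ∈ Submodule.span (ZMod 2) (Set.range fun i : Fin D2.length => ofBits 72 D2[i]) :=
  ker_subset_span_of_core_aug comm72 core72

/-! ## Word bounds, L1 upstairs, push-forward tables -/

/-- All generators of `ker H^X₂₈₈` are words below `2^288`. -/
theorem hbd288 : wordsLtOK 288 (bb288HZ ++ LZ288) = true := by
  simp only [wordsLtOK, List.all_append, Bool.and_eq_true]
  exact ⟨words288_lt.2.1, words288_lt.2.2⟩

/-- **L1 upstairs in label form** (hypothesis `hLab` of T0): a kernel word of `H^X₂₈₈` on which the 12 dual words
`LX288` are all even is a stabilizer. -/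
theorem hLab288 : ∀ v : ℕ, synZero 288 bb288HX v = true →
    (∀ i : ℕ, i < 12 → popc 288 (LX288.getD i 0 &&& v) % 2 = 0) → ofBits 288 v ∈ rowSpace (rowMatrix 288 bb288HZ) :=
  fun _ hs hev => hLab_of_core BB288.comm_flat288 core288 hs hev

/-- **`hpushKer`** of T2: `P₁ v ∈ ker H^X₁₄₄` and `Lam2`-annihilated for every `v ∈ ker H^X₂₈₈`. -/
theorem hpushKer288 : ∀ v : ℕ, v < 2 ^ cov1.n → synZero cov1.n bb288HX v = true →
    synZero cov1.nq bb144HX (cov1.push v) = true ∧ ∀ l ∈ Lam2, popc cov1.nq (l &&& cov1.push v) % 2 = 0 :=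
  pushKer_of_core BB288.comm_flat288 core288 hbd288 gens1_ok.1 gens1_ok.2

/-- The double push-forward of every generator of `ker H^X₂₈₈` is an `H^Z₇₂`-row combination (rows: row tables twice;
logicals: `pushedLZ_eq` + `decomp72_ok`). -/
theorem hZZ : ∀ x ∈ bb288HZ ++ LZ288, ofBits 72 (cov2.push (cov1.push x)) ∈ rowSpace (rowMatrix 72 bb72HZ) := by
  intro x hx
  rw [List.mem_append] at hx
  rcases hx with hx | hx
  · -- an `H^Z₂₈₈` row: `P₁` row table then `P₂` row table
    obtain ⟨r, hr, rfl⟩ := List.getElem_of_mem hx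
    have h1 := rows_ok.2.1
    have h2 := rows_ok.2.2.2.2.1
    simp only [pushRowsOK, Bool.and_eq_true, List.all_eq_true, List.mem_range, beq_iff_eq] at h1 h2
    have e : bb288HZ[r] = bb288HZ.getD r 0 := by
      rw [List.getD_eq_getElem?_getD, List.getElem?_eq_getElem hr, Option.getD_some]
    have hq : covR1.Q r < bb144HZ.length := h1.1.2 ▸ Cover2.Q_lt covs_ok.2.1 (h1.1.1 ▸ hr)
    rw [e, h1.2 r hr, h2.2 _ hq]
    exact ofBits_getD_mem_rowSpace _ _ _
  · -- a logical: the decided combination table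
    have hd := decomp72_ok
    simp only [List.all_eq_true, List.mem_range, beq_iff_eq] at hd
    have hmem : cov1.push x ∈ pushedLZ := by rw [← pushedLZ_eq]; exact List.mem_map.2 ⟨x, hx, rfl⟩
    obtain ⟨j, hj, e⟩ := List.getElem_of_mem hmem
    have hj12 : j < 12 := lt_of_lt_of_eq hj (by decide)
    have e' : pushedLZ.getD j 0 = cov1.push x := by
      rw [List.getD_eq_getElem?_getD, List.getElem?_eq_getElem hj, Option.getD_some]; exact e
    rw [← e', hd j hj12]
    exact ofBits_xorSel_mem_rowSpace _ _ _

/-- **`hspan2`** of T2: `P₂ (P₁ v) ∈ rowspace H^Z₇₂` for every `v ∈ ker H^X₂₈₈` (word-form L1 + `hZZ`). -/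
theorem hspan2_288 : ∀ v : ℕ, v < 2 ^ cov1.n → synZero cov1.n bb288HX v = true →
    ofBits cov2.nq (cov2.push (cov1.push v)) ∈ rowSpace (rowMatrix cov2.nq bb72HZ) := by
  have hsel : ∀ L : List ℕ, (∀ x ∈ L, x ∈ bb288HZ ++ LZ288) → ∀ m : ℕ,
      ofBits 72 (cov2.push (cov1.push (xorSel L m))) ∈ rowSpace (rowMatrix 72 bb72HZ) := by
    intro L hL m
    rw [Cover2.push_xorSel, Cover2.push_xorSel]
    refine ofBits_xorSel_mem_of_forall _ _ (fun x hx => ?_) m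
    rw [List.mem_map] at hx
    obtain ⟨y, hy, rfl⟩ := hx
    rw [List.mem_map] at hy
    obtain ⟨g, hg, rfl⟩ := hy
    exact hZZ g (hL g hg)
  intro v hv hsyn
  obtain ⟨w, w', rfl⟩ := exists_words_of_synZero BB288.comm_flat288 core288 hbd288 hv hsyn
  change ofBits 72 _ ∈ rowSpace (rowMatrix 72 bb72HZ)
  rw [Cover2.push_xor, Cover2.push_xor, ofBits_xor]
  exact Submodule.add_mem _ (hsel _ (fun x hx => List.mem_append_left _ hx) w)
    (hsel _ (fun x hx => List.mem_append_right _ hx) w')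

/-! ## The `u = 0` case and the `H^Z₁₄₄`-row shortcut, from BB144's kernel distance -/

/-- The certificate of `Theorems/BB144DistanceCertificateNoZLogicalBelowTwelve` has the cover's word lists (`X`). -/
theorem cert144_HX : BB144.cert.HX = bb144HX := by
  set_option maxRecDepth 8192 in rfl

/-- (same, `Z` side) -/
theorem cert144_HZ : BB144.cert.HZ = bb144HZ := by
  set_option maxRecDepth 8192 in rfl

/-- BB144's flat `Z`-distance (`twelve_le`, KERNEL) in the `11 < ‖w‖` form on the cover's word lists. -/
theorem twelve_le11 : ∀ w : Fin 144 → ZMod 2, rowMatrix 144 bb144HX *ᵥ w = 0 →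
    w ∉ rowSpace (rowMatrix 144 bb144HZ) → 11 < hammingNorm w := by
  have key : ∀ HX HZ : List ℕ, BB144.cert.HX = HX → BB144.cert.HZ = HZ → ∀ w : Fin 144 → ZMod 2,
      rowMatrix 144 HX *ᵥ w = 0 → w ∉ rowSpace (rowMatrix 144 HZ) → 11 < hammingNorm w := by
    rintro _ _ rfl rfl w hw hw'
    exact lt_of_lt_of_le (by norm_num) (BB144.twelve_le w hw hw')
  exact key _ _ cert144_HX cert144_HZ

/-- No bad word of `BB.bb288` of weight `≤ 22` pushes forward to `0` (quotient distance `12`: `22 < 24`). -/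
theorem noBadOver_zero22 : NoBadOver cov1 bb288HX bb288HZ 22 0 :=
  noBadOver_zero_of_quotient covs_ok.1 covs_ok.2.1 rows_ok.1 rows_ok.2.2.1 (by norm_num)
    (flat_word_of_flat_vec twelve_le11)

/-- **`hzero`** of T1: no bad word of weight `≤ 16` pushes forward to `0`. -/
theorem noBadOver_zero16 : NoBadOver cov1 bb288HX bb288HZ 16 0 :=
  fun v hv hs hn hw => noBadOver_zero22 v hv hs hn (by omega)

/-- **The `H^Z₁₄₄`-row shortcut**: no bad word of weight `≤ 16` pushes forward to the push-forward of an `H^Z₂₈₈` row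
(weight `6`; `16 + 6 = 22 < 24`). -/
theorem noBadOver_pushRow {r : ℕ} (hr : r ∈ bb288HZ) (hw : popc 288 r ≤ 6) :
    NoBadOver cov1 bb288HX bb288HZ 16 (cov1.push r) :=
  noBadOver_push_of_zero BB288.comm_flat288 noBadOver_zero22 hr
    (lt_of_wordsLtOK hbd288 r (List.mem_append_left _ hr)) (by change 16 + popc 288 r ≤ 22; omega)

/-! ## The tail: flat word statement ⇒ the route items -/

/-- The flat word statement closes route item `NoZLogicalBelowEighteen` (parity `16 → 18` and the typed transport are
`Theorems/BB288DistanceCertificateLowerZOfFlat`, p500427). -/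
theorem closes_of_flat
    (h : ∀ v : ℕ, v < 2 ^ 288 → synZero 288 bb288HX v = true → ofBits 288 v ∉ rowSpace (rowMatrix 288 bb288HZ) →
      16 < popc 288 v) :
    Summit.Ventures.QEC.Theses.BB288DistanceCertificate.NoZLogicalBelowEighteen :=
  BB288.noZLogicalBelowEighteen_of_lowZ16 (flat_vec_of_flat_word h)

/-- … and route target `Target` (`[[288,12,18]]` exactly). -/
theorem target_of_flat
    (h : ∀ v : ℕ, v < 2 ^ 288 → synZero 288 bb288HX v = true → ofBits 288 v ∉ rowSpace (rowMatrix 288 bb288HZ) →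
      16 < popc 288 v) :
    Summit.Ventures.QEC.Theses.BB288DistanceCertificate.Target :=
  BB288.target288_of_lowZ16 (flat_vec_of_flat_word h)

end Summit.Ventures.QEC.Census.BB288Cover
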